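/-
Copyright (c) 2026 the pub-hodgecm-mathlib formalisation cell (harness21).  Prover seat hodgecm-mathlib-K2E5-p10 (g4), Track B «K2-LIT» ∕ h413
(`stmt-HodgeConjecture-24833`), line `K2_E3_EllipticInputs`, unit U12, §L leaf (LBGL-2b) brick (b-ii)/(Q), part 2: THE SQUARING PUSH-FORWARD OF THE ADDITIVE
HAAR MEASURE OF A NON-ARCHIMEDEAN LOCAL FIELD — `∫ g(u²) du = (2∕‖2‖) ∫_{x ∈ (Fˣ)²} g(x) ‖x‖^{-1∕2} dx`.  2026-09-04.
-/
import Summits.HodgeConjecture.HodgeConjecture.Theorems.K2E3LocalFieldSquaresHensel   -- ★ part 1 (this seat): Hensel, squares open, the squaring map near `±1`, measure dictionary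
import Mathlib.MeasureTheory.Measure.Haar.Unique
import HarnessLib

/-!
# K2_E3 road (h413), §L brick (Q) part 2 — the squaring push-forward of Haar measure on a non-archimedean local field

Cell `pub/hodgecm-mathlib` (D-0151), Track B, seat K2E5-p10 (g4) (free E5 hand on the E3 §L line; §L lead K2E3-p12 (g4), dealer K2E3-plan (g2)).
`--supports stmt-HodgeConjecture-24833 --as helper`; THEOREMS ONLY (no definition ∕ instance ∕ notation ∕ named fact ∕ `sorry`); never imports
`Cruxes/…/Lines`.  COUNT-NEUTRAL.

The leaf (LBGL-2b) `sig_K2E3GL2RegularNilpotentFourier` of U12 (Harish-Chandra's regularity theorem for `μ̂_reg` on `𝔤𝔩₂(F)`) is, after ★ p856988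
(K2E5-p17 (g3), line Fourier inversion), the Lie–Weyl formula for the Borel slice `K × 𝔟 → 𝔤𝔩₂(F)`; its only genuinely non-linear input is the
ONE-DIMENSIONAL change of variables `s ↦ x₂ s² + (x₁ − x₄) s`, whose Jacobian `‖2 x₂ s + x₁ − x₄‖ = ‖disc χ_X‖^{1∕2}` is the Weyl discriminant.  This file
supplies that input for a non-archimedean local field `F` of characteristic `≠ 2` with additive Haar measure `μ` and `d×u = du∕‖u‖` on `Fˣ`:
* **`map_sq_unitsMeasure_eq_smul_restrict`** — the image of `d×u` under `u ↦ u²` is `(2∕‖2‖) · d×x` restricted to the open subgroup of squares: the image is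
  carried by the squares and invariant under multiplication by squares, so on that open subgroup it is a left-invariant Radon measure, hence a multiple
  of Haar measure (Mathlib `isMulLeftInvariant_eq_smul`); the multiple is read off on `V = {‖u − 1‖ ≤ r}`, `r < ‖2‖²`, whose preimage is
  `{‖u − 1‖ ≤ r∕‖2‖} ⊔ {‖u + 1‖ ≤ r∕‖2‖}` (★ part 1), of `d×u`-mass `2 ‖2‖⁻¹ · d×u(V)`;
* `lintegral_unitsMeasure_comp_sq` (`∫⁻ H(u²) d×u = (2∕‖2‖) ∫⁻_{squares} H d×u`), `lintegral_eq_lintegral_unitsMeasure_mul` (`∫⁻ G dμ = ∫⁻ G ‖u‖ d×u`);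
* **`lintegral_comp_sq_eq`** — the additive form `∫⁻ u, g (u ^ 2) ∂μ = (2∕‖2‖) ∫⁻ x in {x | IsSquare x ∧ x ≠ 0}, (√‖x‖)⁻¹ g x ∂μ` for measurable `g ≥ 0`.
[Weil1965, Chap. I n° 2–6 (change of variables on local fields)] [Igusa1978, Ch. II §7] [Serre1973CourseArithmetic, Ch. II §3.3 (squares in `ℚ_pˣ`)]
HONEST LABEL: HC_CM is proved only modulo the 7 printed citations (2 remaining named inputs: hLiu418 = stmt-HodgeConjecture-24832, h413 =
stmt-HodgeConjecture-24833) until rung 0 closes; count-neutral helper toward (LBGL-2b); (L-B_GL) :478 of U12 stays OPEN.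

## References
* [Weil1965] A. Weil, *Sur la formule de Siegel dans la théorie des groupes classiques*, Acta Math. 113 (1965), Chap. I n° 2–6.
* [Igusa1978] J.-I. Igusa, *Lectures on Forms of Higher Degree*, Tata Institute (1978), Ch. II §7 (Jacobians of polynomial maps over local fields).
* [Serre1973CourseArithmetic] J.-P. Serre, *A Course in Arithmetic* (1973), Ch. II §3.3.
* [Tate1950] J. Tate, *Fourier analysis in number fields and Hecke's zeta-functions* (1950), §2.2–2.3.
-/

set_option autoImplicit false
set_option linter.dupNamespace false   -- `Summit.HodgeConjecture.HodgeConjecture.…` (D-0017 nested layout; lakefile exemption for Summits)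

noncomputable section

open MeasureTheory Measure Filter Topology Set
open scoped NNReal ENNReal Pointwise
open ValuativeRel
open Literature.NumberTheory.Automorphic Literature.NumberTheory.Automorphic.LocalFieldHaar
open Literature.NumberTheory.GaloisRepresentations Literature.NumberTheory.GaloisRepresentations.IsNonarchimedeanLocalField
open Summit.HodgeConjecture.HodgeConjecture.Cruxes.H413.K2E3LocalFieldSquaresHensel

namespace Summit.HodgeConjecture.HodgeConjecture.Cruxes.H413.K2E3LocalFieldSquarePushforward

variable {F : Type*} [Field F] [ValuativeRel F] [TopologicalSpace F] [IsNonarchimedeanLocalField F]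

section Measure

variable [MeasurableSpace F] [BorelSpace F] (μ : Measure F) [μ.IsAddHaarMeasure]

/-- **THE SQUARING PUSH-FORWARD ON `Fˣ`**: the image of the multiplicative Haar measure `ν = d×u = du∕‖u‖` under `u ↦ u²` is `(2∕‖2‖) · ν`
restricted to the (open) subgroup of squares.  Proof: the image `ρ` is supported on the squares `Sq` and invariant under multiplication by squares,
so on the open subgroup `Sq` it is a left-invariant Radon measure, hence `c · ν|_{Sq}` (Mathlib `isMulLeftInvariant_eq_smul`); reading both sides on
`V = {‖u − 1‖ ≤ r}`, `r < ‖2‖²` (`V ⊆ Sq`, `ρ(V) = ν{‖u ∓ 1‖ ≤ r∕‖2‖} = 2 ‖2‖⁻¹ ν(V)`) gives `c = 2∕‖2‖`.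
[cite: Weil1965, Chap. I n° 2–6] [cite: Igusa1978, Ch. II §7] -/
theorem map_sq_unitsMeasure_eq_smul_restrict (h2 : (2 : F) ≠ 0) :
    (Measure.comap ((↑) : Fˣ → F) (μ.withDensity fun x => (((normAbs F x)⁻¹ : ℝ≥0) : ℝ≥0∞))).map (fun u : Fˣ => u ^ 2) =
      (((2 : ℝ≥0) / normAbs F 2 : ℝ≥0) : ℝ≥0∞) •
        (Measure.comap ((↑) : Fˣ → F) (μ.withDensity fun x => (((normAbs F x)⁻¹ : ℝ≥0) : ℝ≥0∞))).restrict {u : Fˣ | IsSquare u} := by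
  haveI : T2Space F := (isLocalField F).toT2Space
  haveI : LocallyCompactSpace F := (isLocalField F).toLocallyCompactSpace
  haveI : SecondCountableTopology F := secondCountableTopology_localField F
  haveI : BorelSpace Fˣ := Units.borelSpace
  have hemb := isOpenEmbedding_unitsVal (F := F)
  haveI : LocallyCompactSpace Fˣ := hemb.locallyCompactSpace
  haveI : SecondCountableTopology Fˣ := hemb.isEmbedding.secondCountableTopology
  have hme := measurableEmbedding_unitsVal (F := F)
  set ν : Measure Fˣ := Measure.comap ((↑) : Fˣ → F) (μ.withDensity fun x => (((normAbs F x)⁻¹ : ℝ≥0) : ℝ≥0∞)) with hν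
  haveI : ν.IsHaarMeasure := isHaarMeasure_unitsMeasure μ
  have h20 : 0 < normAbs F 2 := pos_iff_ne_zero.2 ((map_ne_zero (normAbs F)).2 h2)
  have hcn : Continuous fun u : Fˣ => normAbs F (u : F) := continuous_normAbs.comp Units.continuous_val
  -- the open subgroup of squares
  set Sq : Subgroup Fˣ := (powMonoidHom 2 : Fˣ →* Fˣ).range with hSq
  have hSqcoe : (Sq : Set Fˣ) = {u : Fˣ | IsSquare u} := coe_range_powMonoidHom_two
  have hSqo : IsOpen (Sq : Set Fˣ) := by rw [hSqcoe]; exact isOpen_setOf_isSquare_units h2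
  have hSqm : MeasurableSet (Sq : Set Fˣ) := hSqo.measurableSet
  -- the image measure `ρ`
  have hsqm : Measurable fun u : Fˣ => u ^ 2 := (continuous_pow 2).measurable
  set ρ : Measure Fˣ := ν.map (fun u : Fˣ => u ^ 2) with hρ
  -- (i) `ρ` is invariant under multiplication by squares
  have hρinv : ∀ (r : Fˣ) (A : Set Fˣ), MeasurableSet A → ρ ((fun x => r ^ 2 * x) ⁻¹' A) = ρ A := by
    intro r A hA
    rw [hρ, Measure.map_apply hsqm hA, Measure.map_apply hsqm (measurableSet_preimage (measurable_const_mul _) hA)]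
    have : (fun u : Fˣ => u ^ 2) ⁻¹' ((fun x => r ^ 2 * x) ⁻¹' A) = (fun u => r * u) ⁻¹' ((fun u : Fˣ => u ^ 2) ⁻¹' A) := by
      ext u; simp only [mem_preimage, mul_pow]
    rw [this, measure_preimage_mul]
  -- (ii) `ρ` is carried by `Sq`
  have hρsupp : ρ (Sq : Set Fˣ)ᶜ = 0 := by
    rw [hρ, Measure.map_apply hsqm hSqm.compl]
    have : (fun u : Fˣ => u ^ 2) ⁻¹' (Sq : Set Fˣ)ᶜ = ∅ := by
      ext u
      simp only [mem_preimage, mem_compl_iff, SetLike.mem_coe, hSq, MonoidHom.mem_range, powMonoidHom_apply, mem_empty_iff_false,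
        iff_false, not_not]
      exact ⟨u, rfl⟩
    rw [this, measure_empty]
  -- (iii) `ρ` of a compact set is finite (norm bounds)
  have hρfin : ∀ K : Set Fˣ, IsCompact K → ρ K < ∞ := by
    intro K hK
    rw [hρ, Measure.map_apply hsqm hK.measurableSet]
    obtain ⟨M, hM⟩ := hK.bddAbove_image hcn.continuousOn
    obtain ⟨M', hM'⟩ := hK.bddAbove_image ((continuous_normAbs.comp (Units.continuous_val.comp continuous_inv)).continuousOn)
    have hMu : ∀ u ∈ K, normAbs F (u : F) ≤ max M 1 := fun u hu => (hM ⟨u, hu, rfl⟩).trans (le_max_left _ _)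
    have hM'0 : 0 < max M' 1 := lt_of_lt_of_le zero_lt_one (le_max_right _ _)
    have hMl : ∀ u ∈ K, (max M' 1)⁻¹ ≤ normAbs F (u : F) := by
      intro u hu
      have h := (hM' ⟨u, hu, rfl⟩).trans (le_max_left M' 1)
      simp only [Function.comp_apply, Units.val_inv_eq_inv_val, map_inv₀] at h
      have hu0 : 0 < normAbs F (u : F) := pos_iff_ne_zero.2 ((map_ne_zero (normAbs F)).2 u.ne_zero)
      rw [inv_le_comm₀ hM'0 hu0]; exact h
    -- the preimage lies in `{(max M' 1)⁻¹ ≤ ‖u‖ ≤ max M 1}` (`‖u‖ ≤ 1 ⇒ ‖u‖² ≤ ‖u‖`, `1 ≤ ‖u‖ ⇒ ‖u‖ ≤ ‖u‖²`)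
    refine lt_of_le_of_lt (measure_mono ?_) (unitsMeasure_setOf_le_normAbs_le_lt_top μ (inv_pos.2 hM'0) (b := max M 1))
    intro u hu
    have hl := hMl _ hu
    have hr := hMu _ hu
    simp only [Units.val_pow_eq_pow_val, map_pow] at hl hr
    refine ⟨?_, ?_⟩
    · by_cases h1 : normAbs F (u : F) ≤ 1
      · exact hl.trans (pow_le_of_le_one (by positivity) h1 two_ne_zero)
      · exact ((inv_le_one_of_one_le₀ (le_max_right M' 1)).trans (not_le.1 h1).le)
    · by_cases h1 : normAbs F (u : F) ≤ 1
      · exact h1.trans (le_max_right _ _)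
      · exact (le_self_pow₀ (not_le.1 h1).le two_ne_zero).trans hr
  -- transport to the open subgroup `↥Sq`
  have hι : IsOpenEmbedding (Sq.subtype : ↥Sq → Fˣ) := hSqo.isOpenEmbedding_subtypeVal
  have hιm : MeasurableEmbedding (Sq.subtype : ↥Sq → Fˣ) := hι.measurableEmbedding
  haveI : LocallyCompactSpace ↥Sq := hι.locallyCompactSpace
  haveI : SecondCountableTopology ↥Sq := hι.isEmbedding.secondCountableTopology
  set ν' : Measure ↥Sq := ν.comap Sq.subtype with hν'
  haveI : ν'.IsHaarMeasure := IsHaarMeasure.comap (mH := inferInstance) ν hι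
  set ρ' : Measure ↥Sq := ρ.comap Sq.subtype with hρ'
  have hρ'app : ∀ B : Set ↥Sq, ρ' B = ρ (Sq.subtype '' B) := fun B => hιm.comap_apply ρ B
  haveI : ρ'.IsMulLeftInvariant := by
    refine (forall_measure_preimage_mul_iff ρ').1 fun s B hB => ?_
    obtain ⟨r, hr⟩ : ∃ r : Fˣ, r ^ 2 = (s : Fˣ) := MonoidHom.mem_range.1 s.2
    rw [hρ'app, hρ'app]
    have himg : (Sq.subtype : ↥Sq → Fˣ) '' ((fun x => s * x) ⁻¹' B) = (fun x => r ^ 2 * x) ⁻¹' ((Sq.subtype : ↥Sq → Fˣ) '' B) := by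
      ext x
      simp only [mem_image, mem_preimage, Subgroup.coe_subtype]
      constructor
      · rintro ⟨y, hy, rfl⟩
        exact ⟨s * y, hy, by rw [Subgroup.coe_mul, hr]⟩
      · rintro ⟨a, ha, hax⟩
        have hxS : x ∈ Sq := by
          have hx : x = (s : Fˣ)⁻¹ * (a : Fˣ) := by rw [hax, hr, inv_mul_cancel_left]
          rw [hx]; exact Sq.mul_mem (Sq.inv_mem s.2) a.2
        refine ⟨⟨x, hxS⟩, ?_, rfl⟩
        have hsa : s * ⟨x, hxS⟩ = a := Subtype.ext (by rw [Subgroup.coe_mul, ← hr]; exact hax.symm)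
        show s * ⟨x, hxS⟩ ∈ B
        rw [hsa]; exact ha
    rw [himg, hρinv r _ (hιm.measurableSet_image.2 hB)]
  haveI : IsFiniteMeasureOnCompacts ρ' := ⟨fun K hK => by
    rw [hρ'app]; exact hρfin _ (hK.image hι.continuous)⟩
  -- uniqueness on `↥Sq`
  have huniq : ρ' = ρ'.haarScalarFactor ν' • ν' := isMulLeftInvariant_eq_smul ρ' ν'
  set c : ℝ≥0 := ρ'.haarScalarFactor ν' with hc
  -- back on `Fˣ`: `ρ = c • ν|_{Sq}`
  have hρeq : ρ = (c : ℝ≥0∞) • ν.restrict (Sq : Set Fˣ) := by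
    ext A hA
    have hsplit : ρ A = ρ (A ∩ (Sq : Set Fˣ)) := by
      have hres : ρ.restrict (Sq : Set Fˣ) = ρ := Measure.restrict_eq_self_of_ae_mem (mem_ae_iff.2 hρsupp)
      rw [← Measure.restrict_apply hA, hres]
    have himg : (Sq.subtype : ↥Sq → Fˣ) '' ((Sq.subtype : ↥Sq → Fˣ) ⁻¹' A) = A ∩ (Sq : Set Fˣ) := by
      rw [image_preimage_eq_inter_range]; congr 1; ext x; simp
    have hρ'A : ρ' ((Sq.subtype : ↥Sq → Fˣ) ⁻¹' A) = (c : ℝ≥0∞) * ν (A ∩ (Sq : Set Fˣ)) := by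
      rw [huniq, Measure.coe_nnreal_smul_apply, hν', hιm.comap_apply, himg]
    rw [hsplit, ← himg, ← hρ'app, hρ'A, Measure.smul_apply, smul_eq_mul, Measure.restrict_apply hA]
  -- the constant: read both sides on `V = {‖u − 1‖ ≤ r}`, `r = ‖2‖² ∕ q < ‖2‖²`
  set r : ℝ≥0 := normAbs F 2 ^ 2 * ((residueFieldCard F : ℝ≥0)⁻¹) with hrdef
  have hq1 : 1 < (residueFieldCard F : ℝ≥0) := by exact_mod_cast one_lt_residueFieldCard F
  have hr : r < normAbs F 2 ^ 2 := by
    rw [hrdef]; exact mul_lt_of_lt_one_right (pow_pos h20 2) (inv_lt_one_of_one_lt₀ hq1)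
  have hr0 : 0 < r := mul_pos (pow_pos h20 2) (inv_pos.2 (lt_trans zero_lt_one hq1))
  have hr1 : r / normAbs F 2 < 1 := by
    rw [div_lt_one h20]
    refine hr.trans_le ?_
    calc normAbs F 2 ^ 2 = normAbs F 2 * normAbs F 2 := sq _
      _ ≤ normAbs F 2 * 1 := mul_le_mul_of_nonneg_left (normAbs_le_one_iff.2 (by
          have : (2 : F) = ((2 : 𝒪[F]) : F) := by norm_cast
          rw [this]; exact SetLike.coe_mem _)) (by positivity)
      _ = normAbs F 2 := mul_one _
  set V : Set Fˣ := {u : Fˣ | normAbs F ((u : F) - 1) ≤ r} with hVdef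
  set Vp : Set Fˣ := {u : Fˣ | normAbs F ((u : F) - 1) ≤ r / normAbs F 2} with hVpdef
  set Vm : Set Fˣ := {u : Fˣ | normAbs F ((u : F) + 1) ≤ r / normAbs F 2} with hVmdef
  have hcs : Continuous fun u : Fˣ => normAbs F ((u : F) - 1) := continuous_normAbs.comp (Units.continuous_val.sub continuous_const)
  have hca : Continuous fun u : Fˣ => normAbs F ((u : F) + 1) := continuous_normAbs.comp (Units.continuous_val.add continuous_const)
  have hVm : MeasurableSet V := measurableSet_le hcs.measurable measurable_const
  have hVpm : MeasurableSet Vp := measurableSet_le hcs.measurable measurable_const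
  have hVmm : MeasurableSet Vm := measurableSet_le hca.measurable measurable_const
  -- `V ⊆ Sq`
  have hVSq : V ⊆ (Sq : Set Fˣ) := by
    intro u hu
    rw [hSqcoe, mem_setOf_eq, isSquare_units_iff]
    exact isSquare_of_normAbs_sub_one_lt h2 (lt_of_le_of_lt hu hr)
  -- the preimage of `V` under squaring is `Vp ⊔ Vm`
  have hpre : (fun u : Fˣ => u ^ 2) ⁻¹' V = Vp ∪ Vm := by
    ext u
    simp only [hVdef, hVpdef, hVmdef, mem_preimage, mem_setOf_eq, mem_union, Units.val_pow_eq_pow_val]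
    exact normAbs_sq_sub_one_le_iff h2 hr (u : F)
  have hdisj : Disjoint Vp Vm := by
    rw [disjoint_left]
    intro u hu hu'
    exact not_normAbs_sub_one_le_and_add_one_le h2 hr (u : F) ⟨hu, hu'⟩
  -- the three sets lie in the unit sphere, so `ν = μ ∘ val` on them
  have hsph : ∀ {t : ℝ≥0} (u : Fˣ), t < 1 → normAbs F ((u : F) - 1) ≤ t → normAbs F (u : F) = 1 := by
    intro t u ht hu
    have h := normAbs_add_eq_of_lt (a := (1 : F)) (t := (u : F) - 1) (by rw [map_one]; exact lt_of_le_of_lt hu ht)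
    rwa [add_sub_cancel, map_one] at h
  have hsph' : ∀ {t : ℝ≥0} (u : Fˣ), t < 1 → normAbs F ((u : F) + 1) ≤ t → normAbs F (u : F) = 1 := by
    intro t u ht hu
    have h := normAbs_add_eq_of_lt (a := (-1 : F)) (t := (u : F) + 1) (by rw [normAbs_neg, map_one]; exact lt_of_le_of_lt hu ht)
    rw [show (-1 : F) + ((u : F) + 1) = u by ring, normAbs_neg, map_one] at h
    exact h
  have hr1' : r < 1 := lt_of_le_of_lt (by rw [le_div_iff₀ h20]; exact mul_le_of_le_one_right (le_of_lt hr0) (normAbs_le_one_iff.2 (by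
      have : (2 : F) = ((2 : 𝒪[F]) : F) := by norm_cast
      rw [this]; exact SetLike.coe_mem _))) hr1
  have hνV : ν V = μ {x : F | normAbs F x ≤ r} := by
    rw [hν, unitsMeasure_apply_eq_of_subset_sphere μ hVm fun u hu => hsph u hr1' hu, ← measure_setOf_normAbs_sub_le μ 1 r]
    congr 1
    ext x
    simp only [mem_image, mem_setOf_eq, hVdef]
    constructor
    · rintro ⟨u, hu, rfl⟩; exact hu
    · intro hx
      have hx0 : x ≠ 0 := by
        rintro rfl
        rw [zero_sub, normAbs_neg, map_one] at hx
        exact absurd (lt_of_le_of_lt hx hr1') (lt_irrefl 1)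
      exact ⟨Units.mk0 x hx0, hx, rfl⟩
  have hνVp : ν Vp = ((normAbs F 2)⁻¹ : ℝ≥0) * μ {x : F | normAbs F x ≤ r} := by
    rw [hν, unitsMeasure_apply_eq_of_subset_sphere μ hVpm fun u hu => hsph u hr1 hu, ← measure_setOf_normAbs_le_div μ h2 r,
      ← measure_setOf_normAbs_sub_le μ 1 (r / normAbs F 2)]
    congr 1
    ext x
    simp only [mem_image, mem_setOf_eq, hVpdef]
    constructor
    · rintro ⟨u, hu, rfl⟩; exact hu
    · intro hx
      have hx0 : x ≠ 0 := by
        rintro rfl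
        rw [zero_sub, normAbs_neg, map_one] at hx
        exact absurd (lt_of_le_of_lt hx hr1) (lt_irrefl 1)
      exact ⟨Units.mk0 x hx0, hx, rfl⟩
  have hνVm : ν Vm = ν Vp := by
    have : Vm = (fun u : Fˣ => (-1 : Fˣ) * u) ⁻¹' Vp := by
      ext u
      simp only [hVmdef, hVpdef, mem_setOf_eq, mem_preimage, Units.val_neg, neg_one_mul]
      rw [show -(u : F) - 1 = -((u : F) + 1) by ring, normAbs_neg]
    rw [this, measure_preimage_mul]
  -- `ρ V = (2∕‖2‖) ν V` and `ρ V = c ν V`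
  have hρV : ρ V = 2 * (((normAbs F 2)⁻¹ : ℝ≥0) : ℝ≥0∞) * μ {x : F | normAbs F x ≤ r} := by
    rw [hρ, Measure.map_apply hsqm hVm, hpre, measure_union hdisj hVmm, hνVm, hνVp]
    ring
  have hρV' : ρ V = (c : ℝ≥0∞) * μ {x : F | normAbs F x ≤ r} := by
    rw [hρeq, Measure.smul_apply, smul_eq_mul, Measure.restrict_apply hVm, inter_eq_self_of_subset_left hVSq, hνV]
  obtain ⟨hBpos, hBfin⟩ := measure_setOf_normAbs_le_pos_lt_top μ hr0
  have hceq : (c : ℝ≥0∞) = 2 * (((normAbs F 2)⁻¹ : ℝ≥0) : ℝ≥0∞) := by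
    have h := hρV'.symm.trans hρV
    exact (ENNReal.mul_left_inj hBpos.ne' hBfin.ne).1 h
  -- conclude
  rw [hρeq, ← hSqcoe, hceq, div_eq_mul_inv, ENNReal.coe_mul, ENNReal.coe_ofNat]

/-- **`Fˣ`-form of the push-forward**: `∫⁻ H(u²) d×u = (2∕‖2‖) ∫⁻_{squares} H d×u` for every measurable `H ≥ 0` on `Fˣ`.
[cite: Weil1965, Chap. I n° 2–6] [cite: Igusa1978, Ch. II §7] -/
theorem lintegral_unitsMeasure_comp_sq (h2 : (2 : F) ≠ 0) (H : Fˣ → ℝ≥0∞) (hH : Measurable H) :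
    ∫⁻ u, H (u ^ 2) ∂(Measure.comap ((↑) : Fˣ → F) (μ.withDensity fun x => (((normAbs F x)⁻¹ : ℝ≥0) : ℝ≥0∞))) =
      (((2 : ℝ≥0) / normAbs F 2 : ℝ≥0) : ℝ≥0∞) *
        ∫⁻ u in {u : Fˣ | IsSquare u}, H u ∂(Measure.comap ((↑) : Fˣ → F) (μ.withDensity fun x => (((normAbs F x)⁻¹ : ℝ≥0) : ℝ≥0∞))) := by
  haveI : BorelSpace Fˣ := Units.borelSpace
  have hsqm : Measurable fun u : Fˣ => u ^ 2 := (continuous_pow 2).measurable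
  rw [← lintegral_map hH hsqm, map_sq_unitsMeasure_eq_smul_restrict μ h2, lintegral_smul_measure, smul_eq_mul]

/-- Passage between `F` and `Fˣ`: `∫⁻ G dμ = ∫⁻ G(u) ‖u‖ d×u` (`dμ = ‖x‖ d×x` off the null set `{0}`). [cite: Tate1950, §2.3] -/
theorem lintegral_eq_lintegral_unitsMeasure_mul (G : F → ℝ≥0∞) (hG : Measurable G) :
    ∫⁻ x, G x ∂μ = ∫⁻ u, G (u : F) * normAbs F (u : F) ∂(Measure.comap ((↑) : Fˣ → F) (μ.withDensity fun x => (((normAbs F x)⁻¹ : ℝ≥0) : ℝ≥0∞))) := by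
  haveI : T2Space F := (isLocalField F).toT2Space
  have hme := measurableEmbedding_unitsVal (F := F)
  set d : F → ℝ≥0∞ := fun x => (((normAbs F x)⁻¹ : ℝ≥0) : ℝ≥0∞) with hd
  have hdm : Measurable d := measurable_inv_normAbs.coe_nnreal_ennreal
  set μ' : Measure F := μ.withDensity d with hμ'
  have h0 : μ' {0} = 0 := withDensity_absolutelyContinuous μ _ (measure_singleton_zero μ)
  have hΦ : Measurable fun x : F => G x * normAbs F x := hG.mul measurable_normAbs.coe_nnreal_ennreal
  calc ∫⁻ x, G x ∂μ = ∫⁻ x, d x * (G x * normAbs F x) ∂μ := by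
        refine lintegral_congr_ae ?_
        have hae : ∀ᵐ x ∂μ, x ∈ ({0}ᶜ : Set F) := compl_mem_ae_iff.2 (measure_singleton_zero μ)
        filter_upwards [hae] with x hx
        have hx0 : normAbs F x ≠ 0 := (map_ne_zero (normAbs F)).2 hx
        rw [hd]
        show G x = (((normAbs F x)⁻¹ : ℝ≥0) : ℝ≥0∞) * (G x * normAbs F x)
        rw [mul_comm, mul_assoc, ← ENNReal.coe_mul, mul_inv_cancel₀ hx0, ENNReal.coe_one, mul_one]
    _ = ∫⁻ x, G x * normAbs F x ∂μ' := (lintegral_withDensity_eq_lintegral_mul μ hdm hΦ).symm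
    _ = ∫⁻ x, G x * normAbs F x ∂(μ'.restrict (range ((↑) : Fˣ → F))) := by
        rw [Measure.restrict_eq_self_of_ae_mem]
        rw [range_unitsVal]
        exact compl_mem_ae_iff.2 h0
    _ = ∫⁻ x, G x * normAbs F x ∂((Measure.comap ((↑) : Fˣ → F) μ').map ((↑) : Fˣ → F)) := by rw [hme.map_comap]
    _ = _ := hme.lintegral_map _

/-- **THE SQUARING PUSH-FORWARD OF THE ADDITIVE HAAR MEASURE**: for a non-archimedean local field `F` of characteristic `≠ 2`, an additive Haar
measure `μ` and every measurable `g ≥ 0`,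
`∫⁻ u, g (u²) dμ = (2∕‖2‖) ∫⁻_{x ∈ (Fˣ)²} (√‖x‖)⁻¹ g(x) dμ`
(the fibre over a non-zero square `x = u²` is `{±u}`, two points, and `d(u²) = ‖2u‖ du = ‖2‖ ‖x‖^{1∕2} du`).
[cite: Weil1965, Chap. I n° 2–6] [cite: Igusa1978, Ch. II §7] -/
theorem lintegral_comp_sq_eq (h2 : (2 : F) ≠ 0) (g : F → ℝ≥0∞) (hg : Measurable g) :
    ∫⁻ u, g (u ^ 2) ∂μ =
      (((2 : ℝ≥0) / normAbs F 2 : ℝ≥0) : ℝ≥0∞) * ∫⁻ x in {x : F | IsSquare x ∧ x ≠ 0}, ((NNReal.sqrt (normAbs F x))⁻¹ : ℝ≥0) * g x ∂μ := by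
  haveI : T2Space F := (isLocalField F).toT2Space
  haveI : BorelSpace Fˣ := Units.borelSpace
  set ν : Measure Fˣ := Measure.comap ((↑) : Fˣ → F) (μ.withDensity fun x => (((normAbs F x)⁻¹ : ℝ≥0) : ℝ≥0∞)) with hν
  have hSm : MeasurableSet {x : F | IsSquare x ∧ x ≠ 0} := (isOpen_setOf_isSquare_and_ne_zero h2).measurableSet
  have hsqrtm : Measurable fun x : F => (((NNReal.sqrt (normAbs F x))⁻¹ : ℝ≥0) : ℝ≥0∞) :=
    (NNReal.continuous_sqrt.measurable.comp measurable_normAbs).inv.coe_nnreal_ennreal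
  -- left-hand side on `Fˣ`
  have hL : ∫⁻ u, g (u ^ 2) ∂μ = ∫⁻ u, (fun w : Fˣ => g (w : F) * NNReal.sqrt (normAbs F (w : F))) (u ^ 2) ∂ν := by
    rw [lintegral_eq_lintegral_unitsMeasure_mul μ (fun x => g (x ^ 2)) (hg.comp (continuous_pow 2).measurable)]
    refine lintegral_congr fun u => ?_
    simp only [Units.val_pow_eq_pow_val, map_pow, NNReal.sqrt_sq]
  -- right-hand side on `Fˣ`
  have hR : ∫⁻ x in {x : F | IsSquare x ∧ x ≠ 0}, ((NNReal.sqrt (normAbs F x))⁻¹ : ℝ≥0) * g x ∂μ =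
      ∫⁻ u in {u : Fˣ | IsSquare u}, g (u : F) * NNReal.sqrt (normAbs F (u : F)) ∂ν := by
    rw [← lintegral_indicator hSm, lintegral_eq_lintegral_unitsMeasure_mul μ
      (fun x => {x : F | IsSquare x ∧ x ≠ 0}.indicator (fun x => (((NNReal.sqrt (normAbs F x))⁻¹ : ℝ≥0) : ℝ≥0∞) * g x) x)
      ((hsqrtm.mul hg).indicator hSm), ← lintegral_indicator (isOpen_setOf_isSquare_units h2).measurableSet]
    refine lintegral_congr fun u => ?_
    have hind : ({x : F | IsSquare x ∧ x ≠ 0}.indicator (fun x => (((NNReal.sqrt (normAbs F x))⁻¹ : ℝ≥0) : ℝ≥0∞) * g x) (u : F)) =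
        {u : Fˣ | IsSquare u}.indicator (fun w : Fˣ => (((NNReal.sqrt (normAbs F (w : F)))⁻¹ : ℝ≥0) : ℝ≥0∞) * g (w : F)) u := by
      by_cases hu : IsSquare u
      · rw [indicator_of_mem (show u ∈ {u : Fˣ | IsSquare u} from hu),
          indicator_of_mem (show (u : F) ∈ {x : F | IsSquare x ∧ x ≠ 0} from ⟨(isSquare_units_iff u).1 hu, u.ne_zero⟩)]
      · rw [indicator_of_notMem (show u ∉ {u : Fˣ | IsSquare u} from hu), indicator_of_notMem]
        rintro ⟨h, -⟩
        exact hu ((isSquare_units_iff u).2 h)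
    rw [hind]
    by_cases hu : IsSquare u
    · rw [indicator_of_mem (show u ∈ {u : Fˣ | IsSquare u} from hu), indicator_of_mem (show u ∈ {u : Fˣ | IsSquare u} from hu)]
      have hn0 : normAbs F (u : F) ≠ 0 := (map_ne_zero (normAbs F)).2 u.ne_zero
      have hs0 : NNReal.sqrt (normAbs F (u : F)) ≠ 0 := by rwa [ne_eq, NNReal.sqrt_eq_zero]
      rw [mul_comm _ (g _), mul_assoc, ← ENNReal.coe_mul]
      congr 2
      rw [eq_comm, eq_inv_mul_iff_mul_eq₀ hs0]
      exact NNReal.mul_self_sqrt _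
    · rw [indicator_of_notMem (show u ∉ {u : Fˣ | IsSquare u} from hu), indicator_of_notMem (show u ∉ {u : Fˣ | IsSquare u} from hu),
        zero_mul]
  rw [hL, hR]
  exact lintegral_unitsMeasure_comp_sq μ h2 _ ((hg.comp Units.continuous_val.measurable).mul
    (NNReal.continuous_sqrt.measurable.comp (measurable_normAbs.comp Units.continuous_val.measurable)).coe_nnreal_ennreal)

end Measure

end Summit.HodgeConjecture.HodgeConjecture.Cruxes.H413.K2E3LocalFieldSquarePushforward

end
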